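import Mathlib
import Summits.ResolutionOfSingularities.ResolutionOfSingularities.Theorems.HomologicalConductorPersistenceQuotientAscentCodimTwoLemmas
import HarnessLib

/-!
# Rung S-2 `PersistenceSurface` (stmt-ResolutionOfSingularities-19970) — QUOTIENT ASCENT IN CODIMENSION TWO,
# part 2 (the theorem): `(a, b)` regular with `a, b ∈ caᵐ⁺³(R)`, `c̄ ∈ caᵐ⁺¹(R ⧸ (a, b))` ⇒ `c ∈ caᵐ⁺³(R)`

Route `ResolutionOfSingularities/HomologicalConductor`, chain W4.4b (cell res-hironaka; seat res-L1-w44b-stub-1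
gen 6, lead-1 WAVE-3 row «arena cells (C2 kernel side)»). `[OURS · L1 w44b]` replaces the role of no printed item;
NOT a statement of the manuscript under review (Hironaka 2017), nothing here is attributed to its author; folklore
homological algebra, AI-written (weaker than expert review).

## Why

Stub-2's one-step QUOTIENT ASCENT (`…PersistenceQuotientAscent`, p531707: `a ∈ R⁰ ∩ caᵐ⁺²(R)`,
`c̄ ∈ caᵐ⁺¹(R ⧸ (a))` ⇒ `c ∈ caᵐ⁺²(R)`) gives the chain's cA-ARENA FLOOR `ι(ca(C_h)) ⊆ ca(T_h)`
(`…PersistenceArenaGeneral`, p544909) by TWO steps `T_h = k[x,y,z]/(xy − h) ↠ B_h = k[x,z]/(x² − h) ↠ C_h = k[z]/(h)`,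
the second needing `x̄ ∈ ca(B_h)`, i.e. the Jacobian element `∂ₓ(x² − h) = 2x` — hence `2 ≠ 0`
(res-L1-w44b-tri-2 TRIAGE v18 R68: «p = 2 `A_r` arrivals not covered»).  The hypothesis cannot be removed
step-wise: in characteristic `2`, `x̄ ∉ ca(k[x,t]/(x² − t²))`, and along `T_h ↠ T_h/(x̄) = C_h[y] ↠ C_h` the
middle statement is false (`y ∉ ca(C_h[y])`; `ca(C_h)` does not ascend to `C_h[y]`, the chain's LOSS theorem).

THIS FILE ascends TWO steps AT ONCE, using that BOTH elements of the regular sequence lie in `ca` of the TOP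
ring (for the arena: `a = x̄ − ȳ`, `b = x̄`, both Jacobian, no `2`):

**Theorem (`mem_cohomologyAnnihilatorOfDegree_of_mk_mk_mem`).** `R` noetherian, `a ∈ R⁰`, `b̄ ∈ (R ⧸ (a))⁰`,
`a, b ∈ caᵐ⁺³(R)`, `c ∈ R` whose class lies in `caᵐ⁺¹((R ⧸ (a)) ⧸ (b̄))`.  Then `c ∈ caᵐ⁺³(R)`.

PROOF.  For an `(m+2)`-th syzygy `N` of a finitely generated `X` we show `c · Ext¹_R(N, −) = 0` (CA1).
(1) `a` is `N`-regular and kills `Ext^{≥1}_R(N, −)`, so along `0 → N —a→ N → N̄ = N/aN → 0` the connecting map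
`Ext¹_R(N, Y) → Ext²_R(N̄, Y)` is INJECTIVE (part 1, LEMMA A).  (2) Knörrer's lemma with the complement (part 1):
`Ω_R(N̄) ≅ N ⊕ Ω_R N`, so `b` kills `Ext²_R(N̄, −) = Ext¹_R(Ω N̄, −)`; `b` is `N̄`-regular (Dao–Takahashi), so
`Ext²_R(N̄, Y) → Ext³_R(N̄/bN̄, Y)` is injective as well.  (3) `N̄/bN̄` is an `m`-th syzygy over `R̄̄ = R/(a,b)`
(Dao–Takahashi twice), so `c̄̄ • 𝟙` factors through a finitely generated projective `R̄̄`-module, of projective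
dimension `≤ 2` over `R` (`0 → R̄ —b̄→ R̄ → R̄̄ → 0` over `0 → R —a→ R → R̄ → 0`): `c` kills `Ext³_R(N̄/bN̄, −)`,
hence `Ext²_R(N̄, −)`, hence `Ext¹_R(N, −)`. ∎
This is NOT the composite of two one-step ascents (that would need `b̄ ∈ ca(R ⧸ (a))`, false in the arena).

## Contents

* §1–§4: part 1, `…PersistenceQuotientAscentCodimTwoLemmas` (LEMMA A, retract sums, Knörrer's lemma with complement).
* §5 `hasProjectiveDimensionLT_three_pi_quotQuot`, `hasProjectiveDimensionLT_three_of_projective_quotQuot` —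
  `pd_R P ≤ 2` for `P` finitely generated projective over `(R ⧸ (a)) ⧸ (b̄)`;
  `smul_ext_restrict_quotQuot_eq_zero_of_stablyAnnihilates` — hence `c̄̄ • 𝟙_Q` stably zero over `R̄̄` ⇒ `c` kills
  `Ext^{≥3}_R(Q|_R, −)`.
* §6 `mem_cohomologyAnnihilatorOfDegree_of_mk_mk_mem` — THE THEOREM; ideal form
  `comap_comap_cohomologyAnnihilatorOfDegree_le`, level-free form `…_of_le`, `ca`-form
  `mem_cohomologyAnnihilator_of_mk_mk_mem`; and the PRESENTED form along two surjections `R ↠ R′ ↠ R″` with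
  kernels `(a)`, `(ψ b)` (`mem_cohomologyAnnihilatorOfDegree_of_surjective_surjective`).

Consumer: `…PersistenceArenaFloorCharFree` (the arena floor and the `A_r` table in EVERY characteristic).
References (mechanism only): S. B. Iyengar, R. Takahashi, IMRN 2016, arXiv:1404.1476, Remark 2.12 / 2.13, §2
[`IyengarTakahashi2014`]; H. Dao, R. Takahashi, ANT 8 (2014) Lemma 5.6 [`DaoTakahashi2014`]; H. Knörrer, Invent.
Math. 88 (1987) (the lemma `Ω(N/aN) ≅ N ⊕ ΩN`).
-/

noncomputable section

-- single-problem summit: the doubled namespace component `ResolutionOfSingularities` is forced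
set_option linter.dupNamespace false

namespace Summit.ResolutionOfSingularities.ResolutionOfSingularities.Theorems.HomologicalConductor.QuotientAscentCodimTwo

open CategoryTheory CategoryTheory.Abelian CategoryTheory.Limits Literature.RingTheory.CohomologyAnnihilator
open Summit.ResolutionOfSingularities.ResolutionOfSingularities.Theorems.NoZeno.SandwichCluster
open Summit.ResolutionOfSingularities.ResolutionOfSingularities.Theorems.HomologicalConductor.QuotientHypersurfaceSaturation
open Summit.ResolutionOfSingularities.ResolutionOfSingularities.Theorems.HomologicalConductor.QuotientAscent
open scoped Pointwise nonZeroDivisors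

universe w t v u

/-! ## §5 Projective dimension over `R` of projective modules over `R/(a,b)` -/

section ProjDim

variable {R : Type u} [CommRing R]

/-- `pd_R ((R̄ ⧸ (b̄))ⁿ) ≤ 2` for `R̄ = R ⧸ (a)`, `a ∈ R⁰`, `b̄ ∈ R̄⁰`: the sequence
`0 → R̄ⁿ —b̄→ R̄ⁿ → (R̄ ⧸ (b̄))ⁿ → 0` of `R`-modules with `pd_R R̄ⁿ ≤ 1`
(`hasProjectiveDimensionLT_two_pi_quotient`). [folklore] -/
theorem hasProjectiveDimensionLT_three_pi_quotQuot (a : R) (ha : a ∈ R⁰) (b' : R ⧸ Ideal.span {a})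
    (hb : b' ∈ (R ⧸ Ideal.span {a})⁰) (n : ℕ) :
    HasProjectiveDimensionLT (ModuleCat.of R (Fin n → (R ⧸ Ideal.span {a}) ⧸ Ideal.span {b'})) 3 := by
  let Rb := R ⧸ Ideal.span {a}
  let q₀ : Rb →ₗ[R] Rb ⧸ Ideal.span {b'} := (Ideal.Quotient.mkₐ R (Ideal.span {b'})).toLinearMap
  have hq₀ : ∀ x, q₀ x = Ideal.Quotient.mk (Ideal.span {b'}) x := fun x => rfl
  let q : (Fin n → Rb) →ₗ[R] (Fin n → Rb ⧸ Ideal.span {b'}) := q₀.compLeft (Fin n)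
  have hq : ∀ v i, q v i = Ideal.Quotient.mk (Ideal.span {b'}) (v i) := fun v i => rfl
  have hqsurj : Function.Surjective q := fun w => by
    choose v hv using fun i => Ideal.Quotient.mk_surjective (w i)
    exact ⟨v, funext fun i => by rw [hq, hv]⟩
  let mf : (Fin n → Rb) →ₗ[R] (Fin n → Rb) := (LinearMap.lsmul Rb (Fin n → Rb) b').restrictScalars R
  have hmf : ∀ v, mf v = b' • v := fun v => rfl
  have hinj : Function.Injective mf := by
    intro v v' h
    rw [hmf, hmf] at h
    funext i
    have hi := congrFun h i
    simp only [Pi.smul_apply, smul_eq_mul] at hi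
    exact (mul_cancel_left_mem_nonZeroDivisors hb).mp hi
  have hex : Function.Exact mf q := by
    intro v
    constructor
    · intro hv
      have hvi : ∀ i, ∃ r, v i = b' * r := fun i => by
        have : Ideal.Quotient.mk (Ideal.span {b'}) (v i) = 0 := by rw [← hq]; exact congrFun hv i
        rw [Ideal.Quotient.eq_zero_iff_mem, Ideal.mem_span_singleton'] at this
        obtain ⟨r, hr⟩ := this
        exact ⟨r, by rw [← hr, mul_comm]⟩
      choose r hr using hvi
      refine ⟨r, funext fun i => ?_⟩
      rw [hmf, Pi.smul_apply, smul_eq_mul, ← hr]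
    · rintro ⟨v', rfl⟩
      funext i
      rw [hq, hmf, Pi.smul_apply, smul_eq_mul, Pi.zero_apply, Ideal.Quotient.eq_zero_iff_mem]
      exact Ideal.mul_mem_right _ _ (Ideal.subset_span rfl)
  obtain ⟨w, hS⟩ := exists_shortExact_of_linearMap (Y := ModuleCat.of R (Fin n → Rb))
    (M := ModuleCat.of R (Fin n → Rb)) (X := ModuleCat.of R (Fin n → Rb ⧸ Ideal.span {b'})) mf q hinj
    hqsurj hex
  haveI h2 : HasProjectiveDimensionLT (ModuleCat.of R (Fin n → Rb)) 2 :=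
    hasProjectiveDimensionLT_two_pi_quotient a ha n
  have h3 : HasProjectiveDimensionLT (ModuleCat.of R (Fin n → Rb)) (2 + 1) :=
    hasProjectiveDimensionLT_of_ge _ 2 (2 + 1) (by omega)
  exact hS.hasProjectiveDimensionLT_X₃ 2 h2 h3

/-- `pd_R P ≤ 2` for every finitely generated projective module `P` over `R̄̄ = (R ⧸ (a)) ⧸ (b̄)` (`a ∈ R⁰`,
`b̄ ∈ (R ⧸ (a))⁰`): a retract of some `R̄̄ⁿ`. [folklore] -/
theorem hasProjectiveDimensionLT_three_of_projective_quotQuot (a : R) (ha : a ∈ R⁰) (b' : R ⧸ Ideal.span {a})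
    (hb : b' ∈ (R ⧸ Ideal.span {a})⁰) (P : ModuleCat.{u} ((R ⧸ Ideal.span {a}) ⧸ Ideal.span {b'}))
    [Module.Finite ((R ⧸ Ideal.span {a}) ⧸ Ideal.span {b'}) P]
    [Module.Projective ((R ⧸ Ideal.span {a}) ⧸ Ideal.span {b'}) P] :
    HasProjectiveDimensionLT ((restrictScalarsFunctor R ((R ⧸ Ideal.span {a}) ⧸ Ideal.span {b'})).obj P) 3 := by
  let Rbb := (R ⧸ Ideal.span {a}) ⧸ Ideal.span {b'}
  obtain ⟨n, g, hg⟩ := Module.Finite.exists_fin' Rbb P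
  obtain ⟨s, hs⟩ := Module.projective_lifting_property g LinearMap.id hg
  letI : Module R P := Module.compHom P (algebraMap R Rbb)
  haveI : IsScalarTower R Rbb P :=
    ⟨fun r y x => by
      obtain ⟨y₁, rfl⟩ := Ideal.Quotient.mk_surjective y
      obtain ⟨y₂, rfl⟩ := Ideal.Quotient.mk_surjective y₁
      show ((r • Ideal.Quotient.mk (Ideal.span {b'}) (Ideal.Quotient.mk (Ideal.span {a}) y₂)) • x : P) =
        algebraMap R Rbb r • (Ideal.Quotient.mk (Ideal.span {b'}) (Ideal.Quotient.mk (Ideal.span {a}) y₂) • x)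
      rw [← mul_smul]
      rfl⟩
  haveI := hasProjectiveDimensionLT_three_pi_quotQuot a ha b' hb n
  refine Retract.hasProjectiveDimensionLT (Y := ModuleCat.of R (Fin n → Rbb)) ?_ 3
  refine ⟨ModuleCat.ofHom (X := (restrictScalarsFunctor R Rbb).obj P) (Y := ModuleCat.of R (Fin n → Rbb))
      (s.restrictScalars R),
    ModuleCat.ofHom (X := ModuleCat.of R (Fin n → Rbb)) (Y := (restrictScalarsFunctor R Rbb).obj P)
      (g.restrictScalars R), ?_⟩
  ext x
  exact LinearMap.congr_fun hs x

/-- Restriction of scalars along `R → (R ⧸ (a)) ⧸ (b̄)` turns `c̄̄ • f` into `c • f`. [folklore] -/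
theorem restrictScalarsFunctor_map_mkmk_smul (a : R) (b' : R ⧸ Ideal.span {a}) (c : R)
    {M M' : ModuleCat.{u} ((R ⧸ Ideal.span {a}) ⧸ Ideal.span {b'})} (f : M ⟶ M') :
    (restrictScalarsFunctor R ((R ⧸ Ideal.span {a}) ⧸ Ideal.span {b'})).map
        (Ideal.Quotient.mk (Ideal.span {b'}) (Ideal.Quotient.mk (Ideal.span {a}) c) • f) =
      c • (restrictScalarsFunctor R ((R ⧸ Ideal.span {a}) ⧸ Ideal.span {b'})).map f := by
  ext x
  rfl

/-- **`pd_R ≤ 2` transfer.** If `c̄̄` stably annihilates a module `Q` over `R̄̄ = (R ⧸ (a)) ⧸ (b̄)` (`a ∈ R⁰`,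
`b̄ ∈ (R ⧸ (a))⁰`), then `c` kills `Extⁱ_R(Q|_R, Y)` for every `i ≥ 3` and every `R`-module `Y`: the homothety
factors through a finitely generated projective `R̄̄`-module, of projective dimension `≤ 2` over `R`.
[folklore; cite: IyengarTakahashi2014, Remark 2.13] -/
theorem smul_ext_restrict_quotQuot_eq_zero_of_stablyAnnihilates {a : R} (ha : a ∈ R⁰) {b' : R ⧸ Ideal.span {a}}
    (hb : b' ∈ (R ⧸ Ideal.span {a})⁰) {c : R} {Q : ModuleCat.{u} ((R ⧸ Ideal.span {a}) ⧸ Ideal.span {b'})}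
    (h : StablyAnnihilates ((R ⧸ Ideal.span {a}) ⧸ Ideal.span {b'})
      (Ideal.Quotient.mk (Ideal.span {b'}) (Ideal.Quotient.mk (Ideal.span {a}) c)) Q)
    (Y : ModuleCat.{u} R) {i : ℕ} (hi : 3 ≤ i)
    (e : Ext.{u} ((restrictScalarsFunctor R ((R ⧸ Ideal.span {a}) ⧸ Ideal.span {b'})).obj Q) Y i) : c • e = 0 := by
  obtain ⟨P, hPfin, hPproj, ι, π, hιπ⟩ := h
  haveI := hPfin
  haveI : Module.Projective ((R ⧸ Ideal.span {a}) ⧸ Ideal.span {b'}) P := moduleProjective_of_projective P hPproj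
  haveI := hasProjectiveDimensionLT_three_of_projective_quotQuot a ha b' hb P
  have hιπ' : (restrictScalarsFunctor R ((R ⧸ Ideal.span {a}) ⧸ Ideal.span {b'})).map ι ≫
      (restrictScalarsFunctor R ((R ⧸ Ideal.span {a}) ⧸ Ideal.span {b'})).map π =
        c • 𝟙 ((restrictScalarsFunctor R ((R ⧸ Ideal.span {a}) ⧸ Ideal.span {b'})).obj Q) := by
    rw [← CategoryTheory.Functor.map_comp, hιπ, restrictScalarsFunctor_map_mkmk_smul, CategoryTheory.Functor.map_id]
  exact smul_ext_eq_zero_of_comp_eq_smul_id_of_hasProjectiveDimensionLT _ _ hιπ' hi e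

end ProjDim

/-! ## §6 The codimension-two ascent theorem -/

section Ascent

variable {R : Type u} [CommRing R]

/-- **QUOTIENT ASCENT IN CODIMENSION TWO.**  `R` noetherian; `a ∈ R⁰` and `b ∈ R` with `b̄ ∈ (R ⧸ (a))⁰`
(a regular sequence `a, b`), BOTH in `caᵐ⁺³(R)`; `c ∈ R` whose class lies in `caᵐ⁺¹((R ⧸ (a)) ⧸ (b̄))`.  Then
`c ∈ caᵐ⁺³(R)`.  See the module docstring for the proof (Knörrer split + two connecting-map injections +
`pd_R (R/(a,b)) ≤ 2`).  NOT the composite of two one-step ascents: `b` need not lie in `ca(R ⧸ (a))`.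
[OURS · folklore mechanism; cite: IyengarTakahashi2014, Remark 2.12 / 2.13] -/
theorem mem_cohomologyAnnihilatorOfDegree_of_mk_mk_mem [IsNoetherianRing R] {a b : R} (ha : a ∈ R⁰)
    (hb : Ideal.Quotient.mk (Ideal.span {a}) b ∈ (R ⧸ Ideal.span {a})⁰) {m : ℕ}
    (haca : a ∈ cohomologyAnnihilatorOfDegree R (m + 3)) (hbca : b ∈ cohomologyAnnihilatorOfDegree R (m + 3))
    {c : R}
    (hc : Ideal.Quotient.mk (Ideal.span {Ideal.Quotient.mk (Ideal.span {a}) b}) (Ideal.Quotient.mk (Ideal.span {a}) c) ∈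
      cohomologyAnnihilatorOfDegree ((R ⧸ Ideal.span {a}) ⧸ Ideal.span {Ideal.Quotient.mk (Ideal.span {a}) b})
        (m + 1)) :
    c ∈ cohomologyAnnihilatorOfDegree R (m + 3) := by
  rw [mem_cohomologyAnnihilatorOfDegree_succ_iff_forall_isSyzygy]
  intro X N hX hN
  haveI := hX
  haveI : Module.Finite R N := finite_of_isSyzygy (m + 2) hX hN
  -- peel: `N = Ωᵐ⁺¹ X₁`, `X₁ = Ω X`; `a` regular on `X₁` and on `N`
  obtain ⟨X₁, hX₁, hN₁⟩ := isSyzygy_succ_iff_exists_first.mp hN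
  haveI : Module.Finite R X₁ := finite_of_isSyzygy 1 hX hX₁
  have hregX₁ : IsSMulRegular X₁ a := isSMulRegular_of_isSyzygy_succ ha hX₁
  have hregN : IsSMulRegular N a := isSMulRegular_of_isSyzygy_succ ha hN
  -- Dao–Takahashi over `R̄ = R ⧸ (a)`: `N/aN = Ωᵐ⁺¹_{R̄}(X₁/aX₁)`
  obtain ⟨hNq, -⟩ := IsSyzygy.quotSMulTop ha hN₁ hregX₁
  haveI : Module.Finite (R ⧸ Ideal.span {a})
      (ModuleCat.of (R ⧸ Ideal.span {a}) (X₁ ⧸ (a • ⊤ : Submodule R X₁))) :=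
    Module.Finite.of_restrictScalars_finite R _ _
  -- peel over `R̄`: `N̄ = Ωᵐ X₂`, `X₂ = Ω X̄₁`; `b̄` regular on `X₂` and on `N̄`
  obtain ⟨X₂, hX₂, hN₂⟩ := isSyzygy_succ_iff_exists_first.mp hNq
  haveI : Module.Finite (R ⧸ Ideal.span {a}) X₂ := finite_of_isSyzygy 1 inferInstance hX₂
  have hregX₂ : IsSMulRegular X₂ (Ideal.Quotient.mk (Ideal.span {a}) b) := isSMulRegular_of_isSyzygy_succ hb hX₂
  have hregNb : IsSMulRegular (ModuleCat.of (R ⧸ Ideal.span {a}) (N ⧸ (a • ⊤ : Submodule R N)))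
      (Ideal.Quotient.mk (Ideal.span {a}) b) :=
    isSMulRegular_of_isSyzygy_succ hb hNq
  -- Dao–Takahashi over `R̄` with `b̄`: `N̄/b̄N̄ = Ωᵐ_{R̄̄}(X₂/b̄X₂)`
  obtain ⟨hNqq, -⟩ := IsSyzygy.quotSMulTop hb hN₂ hregX₂
  haveI : Module.Finite ((R ⧸ Ideal.span {a}) ⧸ Ideal.span {Ideal.Quotient.mk (Ideal.span {a}) b})
      (ModuleCat.of ((R ⧸ Ideal.span {a}) ⧸ Ideal.span {Ideal.Quotient.mk (Ideal.span {a}) b})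
        (X₂ ⧸ ((Ideal.Quotient.mk (Ideal.span {a}) b) • ⊤ : Submodule (R ⧸ Ideal.span {a}) X₂))) :=
    Module.Finite.of_restrictScalars_finite (R ⧸ Ideal.span {a}) _ _
  -- `c̄̄` stably annihilates `N̄/b̄N̄` over `R̄̄`
  have hstab := (mem_cohomologyAnnihilatorOfDegree_succ_iff_forall_isSyzygy _).mp hc _ _ inferInstance hNqq
  -- `a` kills `Ext¹_R(N, -)`, `b` kills `Ext^{≥1}_R(N, -)`
  have haN : ∀ Y : ModuleCat.{u} R, Module.Finite R Y → ∀ e : Ext.{u} N Y 1, a • e = 0 := by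
    intro Y hY e
    haveI := hY
    exact ext_smul_eq_zero_of_isSyzygy (m + 2) hN Y 1 le_rfl a
      (fun e' => smul_eq_zero_of_mem_cohomologyAnnihilatorOfDegree haca (i := 1 + (m + 2)) (by omega) e') e
  have hbN : ∀ Y : ModuleCat.{u} R, Module.Finite R Y → ∀ j : ℕ, 1 ≤ j → ∀ e : Ext.{u} N Y j, b • e = 0 := by
    intro Y hY j hj e
    haveI := hY
    exact ext_smul_eq_zero_of_isSyzygy (m + 2) hN Y j hj b
      (fun e' => smul_eq_zero_of_mem_cohomologyAnnihilatorOfDegree hbca (i := j + (m + 2)) (by omega) e') e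
  -- Knörrer with complement: `Ω(N/aN) = L ≅ N ⊕ K`, `K = Ω N`; so `b` kills `Ext²_R(N/aN, -)`
  obtain ⟨L, K, hL, hK, i, p, j, q, hsum⟩ := exists_retract_sum_isSyzygy_quotSMulTop hregN haN
  have hb2 : ∀ Y : ModuleCat.{u} R, Module.Finite R Y →
      ∀ e : Ext.{u} (ModuleCat.of R (N ⧸ (a • ⊤ : Submodule R N))) Y (1 + 1), b • e = 0 := by
    intro Y hY e
    obtain ⟨P, _, hPproj, f, g, w, hS⟩ := isSyzygy_one_iff.mp hL
    haveI := hPproj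
    refine smul_ext_X₃_eq_zero_of_shortExact_of_projective' hS (fun eL => ?_) e
    refine ext_smul_eq_zero_of_retract_sum i p j q hsum b (fun eN => hbN Y hY 1 le_rfl eN) (fun eK => ?_) eL
    exact ext_smul_eq_zero_of_isSyzygy 1 hK Y 1 le_rfl b (fun e' => hbN Y hY (1 + 1) (by norm_num) e') eK
  -- the `R`-module `N/aN` and the quotient map onto the double quotient `N̄/b̄N̄|_R` (kernel `b(N/aN)`)
  have hregNbR : IsSMulRegular (ModuleCat.of R (N ⧸ (a • ⊤ : Submodule R N))) b := fun x y hxy => hregNb hxy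
  letI instR : Module R ((N ⧸ (a • ⊤ : Submodule R N)) ⧸ ((Ideal.Quotient.mk (Ideal.span {a}) b) • ⊤ :
      Submodule (R ⧸ Ideal.span {a}) (N ⧸ (a • ⊤ : Submodule R N)))) :=
    Module.compHom _ (algebraMap R ((R ⧸ Ideal.span {a}) ⧸ Ideal.span {Ideal.Quotient.mk (Ideal.span {a}) b}))
  let QR : ModuleCat.{u} R :=
    (restrictScalarsFunctor R ((R ⧸ Ideal.span {a}) ⧸ Ideal.span {Ideal.Quotient.mk (Ideal.span {a}) b})).obj
      (ModuleCat.of ((R ⧸ Ideal.span {a}) ⧸ Ideal.span {Ideal.Quotient.mk (Ideal.span {a}) b})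
        ((N ⧸ (a • ⊤ : Submodule R N)) ⧸ ((Ideal.Quotient.mk (Ideal.span {a}) b) • ⊤ :
          Submodule (R ⧸ Ideal.span {a}) (N ⧸ (a • ⊤ : Submodule R N)))))
  let g₂ : ModuleCat.of R (N ⧸ (a • ⊤ : Submodule R N)) ⟶ QR :=
    ModuleCat.ofHom (X := ModuleCat.of R (N ⧸ (a • ⊤ : Submodule R N))) (Y := QR)
      { toFun := fun x => (Submodule.Quotient.mk x : (N ⧸ (a • ⊤ : Submodule R N)) ⧸
            ((Ideal.Quotient.mk (Ideal.span {a}) b) • ⊤ :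
              Submodule (R ⧸ Ideal.span {a}) (N ⧸ (a • ⊤ : Submodule R N))))
        map_add' := fun _ _ => rfl
        map_smul' := fun _ _ => rfl }
  have hg₂ : Function.Surjective g₂ := by
    intro y
    induction y using Submodule.Quotient.induction_on with
    | _ x => exact ⟨x, rfl⟩
  have hker : ∀ x : ModuleCat.of R (N ⧸ (a • ⊤ : Submodule R N)),
      g₂ x = 0 ↔ x ∈ (b • ⊤ : Submodule R (ModuleCat.of R (N ⧸ (a • ⊤ : Submodule R N)))) := by
    intro x
    change (Submodule.Quotient.mk x : (N ⧸ (a • ⊤ : Submodule R N)) ⧸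
        ((Ideal.Quotient.mk (Ideal.span {a}) b) • ⊤ :
          Submodule (R ⧸ Ideal.span {a}) (N ⧸ (a • ⊤ : Submodule R N)))) = 0 ↔ _
    rw [Submodule.Quotient.mk_eq_zero, Submodule.mem_smul_pointwise_iff_exists,
      Submodule.mem_smul_pointwise_iff_exists]
    constructor
    · rintro ⟨y, -, rfl⟩
      exact ⟨y, Submodule.mem_top, rfl⟩
    · rintro ⟨y, -, rfl⟩
      exact ⟨y, Submodule.mem_top, rfl⟩
  -- conclude: `c` kills `Ext¹_R(N, -)`
  refine stablyAnnihilates_of_forall_smul_ext_one_eq_zero N fun Y hY e => ?_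
  haveI := hY
  -- `c` kills `Ext³_R(N̄/b̄N̄, Y)` (`pd_R ≤ 2`)
  have hc3 : ∀ e₃ : Ext.{u} QR Y (2 + 1), c • e₃ = 0 := fun e₃ =>
    smul_ext_restrict_quotQuot_eq_zero_of_stablyAnnihilates ha hb hstab Y le_rfl e₃
  -- `c` kills `Ext²_R(N/aN, Y)` (LEMMA A along `b`)
  have hc2 : ∀ e₂ : Ext.{u} (ModuleCat.of R (N ⧸ (a • ⊤ : Submodule R N))) Y (1 + 1), c • e₂ = 0 := fun e₂ =>
    smul_ext_eq_zero_of_smul_ext_quot_eq_zero (a := b) hregNbR g₂ hg₂ hker (hb2 Y hY) hc3 e₂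
  -- `c` kills `Ext¹_R(N, Y)` (LEMMA A along `a`)
  exact smul_ext_eq_zero_of_smul_ext_quotSMulTop_eq_zero hregN (haN Y hY) hc2 e

/-- Ideal form: the pull-back of `caᵐ⁺¹((R ⧸ (a)) ⧸ (b̄))` to `R` lies in `caᵐ⁺³(R)`. [OURS] -/
theorem comap_comap_cohomologyAnnihilatorOfDegree_le [IsNoetherianRing R] {a b : R} (ha : a ∈ R⁰)
    (hb : Ideal.Quotient.mk (Ideal.span {a}) b ∈ (R ⧸ Ideal.span {a})⁰) {m : ℕ}
    (haca : a ∈ cohomologyAnnihilatorOfDegree R (m + 3)) (hbca : b ∈ cohomologyAnnihilatorOfDegree R (m + 3)) :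
    ((cohomologyAnnihilatorOfDegree ((R ⧸ Ideal.span {a}) ⧸ Ideal.span {Ideal.Quotient.mk (Ideal.span {a}) b})
        (m + 1)).comap (Ideal.Quotient.mk (Ideal.span {Ideal.Quotient.mk (Ideal.span {a}) b}))).comap
      (Ideal.Quotient.mk (Ideal.span {a})) ≤ cohomologyAnnihilatorOfDegree R (m + 3) :=
  fun _ hc => mem_cohomologyAnnihilatorOfDegree_of_mk_mk_mem ha hb haca hbca hc

/-- Level-free form: `a ∈ R⁰ ∩ caⁿ(R)`, `b ∈ caⁿ'(R)` with `b̄ ∈ (R ⧸ (a))⁰`, `c̄̄ ∈ caⁿ''((R ⧸ (a)) ⧸ (b̄))`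
⇒ `c ∈ caᴺ(R)` for every `N ≥ max(n, n', n'' + 2, 3)`. [OURS] -/
theorem mem_cohomologyAnnihilatorOfDegree_of_mk_mk_mem_of_le [IsNoetherianRing R] {a b : R} (ha : a ∈ R⁰)
    (hb : Ideal.Quotient.mk (Ideal.span {a}) b ∈ (R ⧸ Ideal.span {a})⁰) {n n' n'' N : ℕ}
    (haca : a ∈ cohomologyAnnihilatorOfDegree R n) (hbca : b ∈ cohomologyAnnihilatorOfDegree R n') {c : R}
    (hc : Ideal.Quotient.mk (Ideal.span {Ideal.Quotient.mk (Ideal.span {a}) b}) (Ideal.Quotient.mk (Ideal.span {a}) c) ∈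
      cohomologyAnnihilatorOfDegree ((R ⧸ Ideal.span {a}) ⧸ Ideal.span {Ideal.Quotient.mk (Ideal.span {a}) b}) n'')
    (hnN : n ≤ N) (hn'N : n' ≤ N) (hn''N : n'' + 2 ≤ N) (h3N : 3 ≤ N) :
    c ∈ cohomologyAnnihilatorOfDegree R N := by
  obtain ⟨m, rfl⟩ : ∃ m, N = m + 3 := ⟨N - 3, by omega⟩
  exact mem_cohomologyAnnihilatorOfDegree_of_mk_mk_mem ha hb (cohomologyAnnihilatorOfDegree_mono hnN haca)
    (cohomologyAnnihilatorOfDegree_mono hn'N hbca) (cohomologyAnnihilatorOfDegree_mono (show n'' ≤ m + 1 by omega) hc)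

/-- `ca`-form: for a regular sequence `a, b` of cohomology annihilators of `R`, the pull-back of
`ca((R ⧸ (a)) ⧸ (b̄))` to `R` lies in `ca(R)`. [OURS] -/
theorem mem_cohomologyAnnihilator_of_mk_mk_mem [IsNoetherianRing R] {a b : R} (ha : a ∈ R⁰)
    (hb : Ideal.Quotient.mk (Ideal.span {a}) b ∈ (R ⧸ Ideal.span {a})⁰) (haca : a ∈ cohomologyAnnihilator R)
    (hbca : b ∈ cohomologyAnnihilator R) {c : R}
    (hc : Ideal.Quotient.mk (Ideal.span {Ideal.Quotient.mk (Ideal.span {a}) b}) (Ideal.Quotient.mk (Ideal.span {a}) c) ∈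
      cohomologyAnnihilator ((R ⧸ Ideal.span {a}) ⧸ Ideal.span {Ideal.Quotient.mk (Ideal.span {a}) b})) :
    c ∈ cohomologyAnnihilator R := by
  obtain ⟨n, hn⟩ := mem_cohomologyAnnihilator_iff.mp haca
  obtain ⟨n', hn'⟩ := mem_cohomologyAnnihilator_iff.mp hbca
  obtain ⟨n'', hn''⟩ := mem_cohomologyAnnihilator_iff.mp hc
  exact mem_cohomologyAnnihilator_iff.mpr ⟨n + n' + n'' + 3,
    mem_cohomologyAnnihilatorOfDegree_of_mk_mk_mem_of_le ha hb hn hn' hn'' (by omega) (by omega) (by omega) (by omega)⟩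

/-! ### Presented form: along two surjections `R ↠ R′ ↠ R″` -/

/-- Non-zero-divisors transport along a ring isomorphism. [folklore] -/
theorem mem_nonZeroDivisors_of_ringEquiv {S S' : Type*} [CommRing S] [CommRing S'] (e : S ≃+* S') {x : S}
    (hx : e x ∈ S'⁰) : x ∈ S⁰ := by
  rw [mem_nonZeroDivisors_iff_right] at hx ⊢
  intro y hy
  have h : e y * e x = 0 := by rw [← map_mul, hy, map_zero]
  exact e.injective ((hx _ h).trans (map_zero e).symm)

/-- **QUOTIENT ASCENT IN CODIMENSION TWO, presented along two surjections.**  `R` noetherian; `ψ : R ↠ R′` with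
kernel `(a)`, `a ∈ R⁰`; `π : R′ ↠ R″` with kernel `(ψ b)`, `ψ b ∈ R′⁰`; `a, b ∈ caᵐ⁺³(R)`; `π (ψ c) ∈ caᵐ⁺¹(R″)`.
Then `c ∈ caᵐ⁺³(R)`.  (Lets the two stages be PRESENTED rings, e.g.
`k[x,y,z]/(xy − h) ↠ k[x,z]/(x² − h) ↠ k[z]/(h)`, instead of iterated quotients; transport along
`R ⧸ (a) ≃ R′` and `(R ⧸ (a)) ⧸ (b̄) ≃ R″` by `ringEquiv_apply_mem_cohomologyAnnihilatorOfDegree`.) [OURS] -/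
theorem mem_cohomologyAnnihilatorOfDegree_of_surjective_surjective [IsNoetherianRing R] {R' R'' : Type u}
    [CommRing R'] [CommRing R''] (ψ : R →+* R') (hψ : Function.Surjective ψ) {a : R}
    (hkerψ : RingHom.ker ψ = Ideal.span {a}) (ha : a ∈ R⁰) (π : R' →+* R'') (hπ : Function.Surjective π)
    {b : R} (hkerπ : RingHom.ker π = Ideal.span {ψ b}) (hb : ψ b ∈ R'⁰) {m : ℕ}
    (haca : a ∈ cohomologyAnnihilatorOfDegree R (m + 3)) (hbca : b ∈ cohomologyAnnihilatorOfDegree R (m + 3))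
    {c : R} (hc : π (ψ c) ∈ cohomologyAnnihilatorOfDegree R'' (m + 1)) :
    c ∈ cohomologyAnnihilatorOfDegree R (m + 3) := by
  -- `e₁ : R ⧸ (a) ≃ R′`
  let e₁ : R ⧸ Ideal.span {a} ≃+* R' :=
    (Ideal.quotEquivOfEq hkerψ.symm).trans (RingHom.quotientKerEquivOfSurjective hψ)
  have he₁ : ∀ x, e₁ (Ideal.Quotient.mk (Ideal.span {a}) x) = ψ x := fun x => by
    simp [e₁, Ideal.quotEquivOfEq_mk, RingHom.quotientKerEquivOfSurjective_apply_mk]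
  -- `b̄ ∈ (R ⧸ (a))⁰`
  have hb' : Ideal.Quotient.mk (Ideal.span {a}) b ∈ (R ⧸ Ideal.span {a})⁰ :=
    mem_nonZeroDivisors_of_ringEquiv e₁ (by rw [he₁]; exact hb)
  -- `π ∘ e₁ : R ⧸ (a) ↠ R″` has kernel `(b̄)`
  let π₁ : R ⧸ Ideal.span {a} →+* R'' := π.comp e₁.toRingHom
  have hπ₁ : ∀ x, π₁ x = π (e₁ x) := fun x => rfl
  have hπ₁surj : Function.Surjective π₁ := hπ.comp e₁.surjective
  have hψb : π (ψ b) = 0 := by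
    rw [← RingHom.mem_ker, hkerπ]
    exact Ideal.mem_span_singleton_self _
  have hkerπ₁ : RingHom.ker π₁ = Ideal.span {Ideal.Quotient.mk (Ideal.span {a}) b} := by
    apply le_antisymm
    · intro x hx
      rw [RingHom.mem_ker, hπ₁, ← RingHom.mem_ker, hkerπ, Ideal.mem_span_singleton'] at hx
      obtain ⟨r', hr'⟩ := hx
      obtain ⟨r₀, rfl⟩ := e₁.surjective r'
      rw [← he₁ b, ← map_mul] at hr'
      rw [← e₁.injective hr']
      exact Ideal.mul_mem_left _ _ (Ideal.mem_span_singleton_self _)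
    · rw [Ideal.span_le, Set.singleton_subset_iff, SetLike.mem_coe, RingHom.mem_ker, hπ₁, he₁]
      exact hψb
  -- `e₂ : (R ⧸ (a)) ⧸ (b̄) ≃ R″`
  let e₂ : (R ⧸ Ideal.span {a}) ⧸ Ideal.span {Ideal.Quotient.mk (Ideal.span {a}) b} ≃+* R'' :=
    (Ideal.quotEquivOfEq hkerπ₁.symm).trans (RingHom.quotientKerEquivOfSurjective hπ₁surj)
  have he₂ : e₂ (Ideal.Quotient.mk _ (Ideal.Quotient.mk (Ideal.span {a}) c)) = π (ψ c) := by
    simp [e₂, Ideal.quotEquivOfEq_mk, RingHom.quotientKerEquivOfSurjective_apply_mk, hπ₁, he₁]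
  have hc' := ringEquiv_apply_mem_cohomologyAnnihilatorOfDegree e₂.symm hc
  rw [← he₂, e₂.symm_apply_apply] at hc'
  exact mem_cohomologyAnnihilatorOfDegree_of_mk_mk_mem ha hb' haca hbca hc'

end Ascent

end Summit.ResolutionOfSingularities.ResolutionOfSingularities.Theorems.HomologicalConductor.QuotientAscentCodimTwo

end
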